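import Summits.Ventures.PercRepro.Support

/-!
# Ahlswede–Daykin outside a frozen edge set

For a finite set `K` of edges and two configurations `ω, ω'`, let

* `meetOff K ω ω'` be `ω` on `K` and the meet `ω ⊓ ω'` off `K`,
* `joinOff K ω ω'` be `ω'` on `K` and the join `ω ⊔ ω'` off `K`.

The pair `(ω, ω') ↦ (meetOff K ω ω', joinOff K ω ω')` preserves the product of the weights (edge by
edge the multiset of the two states is unchanged), and for every fixed configuration of the edges
of `K` it is the meet/join of the remaining coordinates.  Hence the four functions theorem applied
fibre by fibre (reveal the edges of `K` with `prob_eq_sum_keepOn`, then `four_functions_theorem_univ`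
under `zeroOn p K`) gives the **frozen Ahlswede–Daykin inequality**
(`prob_mul_prob_le_of_meetOff_joinOff`):

  if `ω ∈ A`, `ω' ∈ B` imply `meetOff K ω ω' ∈ D` and `joinOff K ω ω' ∈ U`, then
  `P_p(A) · P_p(B) ≤ P_p(D) · P_p(U)`.

`K = ∅` is the usual Ahlswede–Daykin inequality for events.  The frozen version is what the
percolation arguments of the form "reveal the clusters of two vertices, then use positive
association on the rest" need: the internal configuration of the revealed clusters is kept from
each configuration separately instead of being met/joined, so the revealed clusters survive.
-/

namespace PercRepro

open Finset

variable {E : Type*} [Fintype E] [DecidableEq E]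

/-- `ω` on the edges of `K`, the meet `ω ⊓ ω'` on the other edges. -/
def meetOff (K : Finset E) (ω ω' : Config E) : Config E :=
  fun f => if f ∈ K then ω f else (ω f && ω' f)

/-- `ω'` on the edges of `K`, the join `ω ⊔ ω'` on the other edges. -/
def joinOff (K : Finset E) (ω ω' : Config E) : Config E :=
  fun f => if f ∈ K then ω' f else (ω f || ω' f)

omit [Fintype E] in
/-- On configurations split as (part on `K`) ⊔ (part off `K`), `meetOff` keeps the first part on
`K` and meets the parts off `K`. -/
theorem meetOff_sup_sup (K : Finset E) {ζ ζ' ω ω' : Config E} (hζ : ∀ e ∉ K, ζ e = false)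
    (hζ' : ∀ e ∉ K, ζ' e = false) (hω : ∀ e ∈ K, ω e = false) (hω' : ∀ e ∈ K, ω' e = false) :
    meetOff K (ζ ⊔ ω) (ζ' ⊔ ω') = ζ ⊔ (ω ⊓ ω') := by
  funext f
  by_cases hf : f ∈ K
  · simp [meetOff, hf, Pi.sup_apply, Pi.inf_apply, hω f hf, hω' f hf]
  · simp [meetOff, hf, Pi.sup_apply, Pi.inf_apply, hζ f hf, hζ' f hf]

omit [Fintype E] in
/-- On configurations split as (part on `K`) ⊔ (part off `K`), `joinOff` keeps the second part on
`K` and joins the parts off `K`. -/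
theorem joinOff_sup_sup (K : Finset E) {ζ ζ' ω ω' : Config E} (hζ : ∀ e ∉ K, ζ e = false)
    (hζ' : ∀ e ∉ K, ζ' e = false) (hω : ∀ e ∈ K, ω e = false) (hω' : ∀ e ∈ K, ω' e = false) :
    joinOff K (ζ ⊔ ω) (ζ' ⊔ ω') = ζ' ⊔ (ω ⊔ ω') := by
  funext f
  by_cases hf : f ∈ K
  · simp [joinOff, hf, Pi.sup_apply, hω f hf, hω' f hf]
  · simp [joinOff, hf, Pi.sup_apply, hζ f hf, hζ' f hf]

/-- Ahlswede–Daykin for the fibres over a revealed configuration: under `zeroOn p K`, for fixed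
parts `ζ, ζ'` on `K`, `P(A_ζ) P(B_ζ') ≤ P(D_ζ) P(U_ζ')` whenever the meet/join hypothesis holds. -/
theorem prob_zeroOn_mul_le_of_meetOff_joinOff {p : E → ℝ} (hp : IsProb p) (K : Finset E)
    {A B D U : Set (Config E)}
    (h : ∀ ω ω', ω ∈ A → ω' ∈ B → meetOff K ω ω' ∈ D ∧ joinOff K ω ω' ∈ U)
    {ζ ζ' : Config E} (hζ : ∀ e ∉ K, ζ e = false) (hζ' : ∀ e ∉ K, ζ' e = false) :
    prob (zeroOn p K) {ω | ζ ⊔ ω ∈ A} * prob (zeroOn p K) {ω | ζ' ⊔ ω ∈ B} ≤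
      prob (zeroOn p K) {ω | ζ ⊔ ω ∈ D} * prob (zeroOn p K) {ω | ζ' ⊔ ω ∈ U} := by
  unfold prob
  have hq := isProb_zeroOn hp K
  refine four_functions_theorem_univ _ _ _ _
    (fun ω => Set.indicator_nonneg (fun ω' _ => weight_nonneg hq ω') ω)
    (fun ω => Set.indicator_nonneg (fun ω' _ => weight_nonneg hq ω') ω)
    (fun ω => Set.indicator_nonneg (fun ω' _ => weight_nonneg hq ω') ω)
    (fun ω => Set.indicator_nonneg (fun ω' _ => weight_nonneg hq ω') ω)
    (fun ω ω' => ?_)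
  by_cases hA : ζ ⊔ ω ∈ A
  swap
  · have : ω ∉ {ω | ζ ⊔ ω ∈ A} := hA
    rw [Set.indicator_of_notMem this, zero_mul]
    exact mul_nonneg (Set.indicator_nonneg (fun ω' _ => weight_nonneg hq ω') _)
      (Set.indicator_nonneg (fun ω' _ => weight_nonneg hq ω') _)
  by_cases hB : ζ' ⊔ ω' ∈ B
  swap
  · have : ω' ∉ {ω | ζ' ⊔ ω ∈ B} := hB
    rw [Set.indicator_of_notMem this, mul_zero]
    exact mul_nonneg (Set.indicator_nonneg (fun ω' _ => weight_nonneg hq ω') _)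
      (Set.indicator_nonneg (fun ω' _ => weight_nonneg hq ω') _)
  by_cases hw : weight (zeroOn p K) ω = 0
  · rw [Set.indicator_of_mem (show ω ∈ {ω | ζ ⊔ ω ∈ A} from hA), hw, zero_mul]
    exact mul_nonneg (Set.indicator_nonneg (fun ω' _ => weight_nonneg hq ω') _)
      (Set.indicator_nonneg (fun ω' _ => weight_nonneg hq ω') _)
  by_cases hw' : weight (zeroOn p K) ω' = 0
  · rw [Set.indicator_of_mem (show ω' ∈ {ω | ζ' ⊔ ω ∈ B} from hB), hw', mul_zero]
    exact mul_nonneg (Set.indicator_nonneg (fun ω' _ => weight_nonneg hq ω') _)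
      (Set.indicator_nonneg (fun ω' _ => weight_nonneg hq ω') _)
  have hω := closedOn_of_weight_zeroOn_ne_zero hw
  have hω' := closedOn_of_weight_zeroOn_ne_zero hw'
  obtain ⟨hD, hU⟩ := h _ _ hA hB
  rw [meetOff_sup_sup K hζ hζ' hω hω'] at hD
  rw [joinOff_sup_sup K hζ hζ' hω hω'] at hU
  rw [Set.indicator_of_mem (show ω ∈ {ω | ζ ⊔ ω ∈ A} from hA),
    Set.indicator_of_mem (show ω' ∈ {ω | ζ' ⊔ ω ∈ B} from hB),
    Set.indicator_of_mem (show ω ⊓ ω' ∈ {ω | ζ ⊔ ω ∈ D} from hD),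
    Set.indicator_of_mem (show ω ⊔ ω' ∈ {ω | ζ' ⊔ ω ∈ U} from hU)]
  exact le_of_eq (weight_inf_mul_weight_sup _ ω ω')

/-- **Ahlswede–Daykin outside a frozen edge set.**  If for all `ω ∈ A` and `ω' ∈ B` the
configuration `meetOff K ω ω'` (`ω` on `K`, meet off `K`) lies in `D` and `joinOff K ω ω'` (`ω'` on
`K`, join off `K`) lies in `U`, then `P_p(A) · P_p(B) ≤ P_p(D) · P_p(U)`.  For `K = ∅` this is the
Ahlswede–Daykin inequality for events. -/
theorem prob_mul_prob_le_of_meetOff_joinOff {p : E → ℝ} (hp : IsProb p) (K : Finset E)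
    {A B D U : Set (Config E)}
    (h : ∀ ω ω', ω ∈ A → ω' ∈ B → meetOff K ω ω' ∈ D ∧ joinOff K ω ω' ∈ U) :
    prob p A * prob p B ≤ prob p D * prob p U := by
  rw [prob_eq_sum_keepOn p K A, prob_eq_sum_keepOn p K B, prob_eq_sum_keepOn p K D,
    prob_eq_sum_keepOn p K U, Finset.sum_mul_sum, Finset.sum_mul_sum]
  refine Finset.sum_le_sum fun ζ _ => Finset.sum_le_sum fun ζ' _ => ?_
  have hk := isProb_keepOn hp K
  by_cases hζ : weight (keepOn p K) ζ = 0
  · simp [hζ]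
  by_cases hζ' : weight (keepOn p K) ζ' = 0
  · simp [hζ']
  have key := prob_zeroOn_mul_le_of_meetOff_joinOff hp K h
    (closedOff_of_weight_keepOn_ne_zero hζ) (closedOff_of_weight_keepOn_ne_zero hζ')
  have hnn : 0 ≤ weight (keepOn p K) ζ * weight (keepOn p K) ζ' :=
    mul_nonneg (weight_nonneg hk ζ) (weight_nonneg hk ζ')
  calc weight (keepOn p K) ζ * prob (zeroOn p K) {ω | ζ ⊔ ω ∈ A} *
        (weight (keepOn p K) ζ' * prob (zeroOn p K) {ω | ζ' ⊔ ω ∈ B})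
      = (weight (keepOn p K) ζ * weight (keepOn p K) ζ') *
          (prob (zeroOn p K) {ω | ζ ⊔ ω ∈ A} * prob (zeroOn p K) {ω | ζ' ⊔ ω ∈ B}) := by ring
    _ ≤ (weight (keepOn p K) ζ * weight (keepOn p K) ζ') *
          (prob (zeroOn p K) {ω | ζ ⊔ ω ∈ D} * prob (zeroOn p K) {ω | ζ' ⊔ ω ∈ U}) :=
        mul_le_mul_of_nonneg_left key hnn
    _ = weight (keepOn p K) ζ * prob (zeroOn p K) {ω | ζ ⊔ ω ∈ D} *
          (weight (keepOn p K) ζ' * prob (zeroOn p K) {ω | ζ' ⊔ ω ∈ U}) := by ring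

/-- The plain Ahlswede–Daykin inequality for events (the case `K = ∅`): if `ω ∈ A`, `ω' ∈ B` imply
`ω ⊓ ω' ∈ D` and `ω ⊔ ω' ∈ U`, then `P_p(A) · P_p(B) ≤ P_p(D) · P_p(U)`. -/
theorem prob_mul_prob_le_of_inf_sup {p : E → ℝ} (hp : IsProb p) {A B D U : Set (Config E)}
    (h : ∀ ω ω', ω ∈ A → ω' ∈ B → ω ⊓ ω' ∈ D ∧ ω ⊔ ω' ∈ U) :
    prob p A * prob p B ≤ prob p D * prob p U := by
  refine prob_mul_prob_le_of_meetOff_joinOff hp ∅ fun ω ω' hA hB => ?_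
  have hm : meetOff ∅ ω ω' = ω ⊓ ω' := by
    funext f
    simp [meetOff, Pi.inf_apply]
  have hj : joinOff ∅ ω ω' = ω ⊔ ω' := by
    funext f
    simp [joinOff, Pi.sup_apply]
  rw [hm, hj]
  exact h ω ω' hA hB

end PercRepro
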